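import Summits.AtomisticToContinuum.BoseEinsteinCondensation.Theses.BECThomsonPrinciple
import Summits.AtomisticToContinuum.BoseEinsteinCondensation.Theorems.GaussianDominationCan.Negative.CruxForms
import Summits.AtomisticToContinuum.BoseEinsteinCondensation.Theorems.GaussianDominationCan.Negative.StructureII
import Literature.MathematicalPhysics.QuantumManyBody.PeriodicBoseGasFracEnergy
import Literature.MathematicalPhysics.QuantumManyBody.PeriodicBoseGasFourier
import Literature.MathematicalPhysics.QuantumManyBody.PeriodicBoseGasUpperBoundProofs
import Literature.MathematicalPhysics.QuantumManyBody.ScatteringLengthRangeHolds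
import Literature.MathematicalPhysics.QuantumManyBody.PeriodicBoseGasMomentumSector

/-!
# Route `BECThomsonPrinciple`, crux `GDTransfer` (stmt-AtomisticToContinuum-9482):
# vocabulary and registered stub statements of the line `dyson-dressed-witness`

`Defs` file (D-0016 `<Route>Defs` convention; precedents `BECGroundStateSOSPeriodicIRBoundDefs.lean`,
`BECConjugateDominationDefs.lean`) of the crux line picked by the lead
(`Summits/AtomisticToContinuum/BoseEinsteinCondensation/Cruxes/GDTransfer/PICKED.md`; reshaped skeleton
`…/Cruxes/GDTransfer/Lines/dyson_dressed_witness.lean`, 7 registered stubs). A `Cruxes/…/Lines/*.lean`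
skeleton is not an importable module, so the objects the line posits and the STATEMENTS of its registered
stubs live here, to be imported verbatim by the stub files `Theorems/BECThomsonPrincipleGDTransfer<Stub>.lean`
(landed `--supports stmt-AtomisticToContinuum-9482`) and by the closing composition.  Nothing open is
asserted: every `def … : Prop` is a statement (of a stub or of an interface between stubs), consumed only as
the type of a stub theorem or as an explicit hypothesis; the theorems proved here are glue and toolkit.

The crux: `GDTransfer : GaussianDominationCan → PeriodicBEC` (canonical `T = 0` Gaussian domination on the
torus, chord form with the Lewin–Nam–Serfaty–Solovej excitation source, implies condensation of the
`δ`-near-minimisers of the periodic energy at every small density).  The line: variational `T = 0`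
Kennedy–Lieb–Shastry — GD differentiated along `(Ψ + tζ)/‖Ψ + tζ‖` is a two-sided dual-norm bound
(`TwoSidedDualNorm`, stub `chordVariation`); the directions are the LNSS pair `Λ_k†Ψ`, `Λ_kΨ`
(configuration-space algebra `LNSSAlgebra`; bare for integrable `v`: `BareAdmissibility`,
`BareSecondVariation`; Dyson-dressed and core-safe for non-integrable `v`: `stub_dressedWitness`), giving a
`DressedWitnessFamilyFor v`; per-mode solve + `ℤ³` window count (`WindowBoundFor v`, stub `windowLaw`);
Parseval + kinetic Chebyshev + Dyson's upper bound (`PeriodicBECFor v`, stub `modeCounting`).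

Objects (over the LANDED vocabulary `Theorems/GaussianDominationCan/Negative/*`: `cellAvg N L i` = the
crux's cell average `P_i`, `modeProj N L S` = `Q_S`, `theta m L` = `Θ = P₀ n̂₀^{-1/2}`, `phase m L n` =
`e^{ik·x₀}`, `sourceIntegral`, `InWindow`; none re-declared):
`srcPair` (off-diagonal source pairing `σ_n(g,h) = ∫ conj(g) e^{ik·x₀} Θ_h`, `srcPair ψ ψ = sourceIntegral` by
`rfl`), `fourierAvg` (`P_i^{(n)}`, flat Fourier coefficient in slot `i`), `rootInv` (`n̂₀^{-1/2}`),
`lnssLower`/`lnssUpper` (`Λ_n = n̂₀^{-1/2}a_0†a_n`, `Λ_n† = a_n†a_0 n̂₀^{-1/2}` in first quantisation),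
`IsDirection`/`mass`/`eform` (unnormalised `C¹` periodic symmetric functions, their `L²` mass and energy
form on the cell), `windowSum`; the interfaces `TwoSidedDualNorm`, `LNSSAlgebra`, `BareAdmissibility`,
`BareSecondVariation`, `DressedWitnessFamilyFor`, `WindowBoundFor`, `PeriodicBECFor`
(`gdTransfer_iff : GDTransfer ↔ (GaussianDominationCan → ∀ v adm, PeriodicBECFor v) := Iff.rfl`); the seven
registered signatures `Sig.stub_*`; the glue `dwf_of_bare` (bare pair ⇒ witness family for integrable `v`)
and `GDTransfer_of` (the seven statements ⇒ the crux by name); the toolkit (`IsDirection.add/sub/const_mul`,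
`mass_ne_top`, `mass_const_mul`, `eform_const_mul`, the variational principle for directions
`IsDirection.groundStateEnergy_mul_mass_le : E₀‖ζ‖² ≤ 𝓔(ζ)`, `windowSum_zero`, `windowSum_occ_le`).

References: KennedyLiebShastry1988 (JSP 53, 1019) and KLS1988PRL; DysonLiebSimon1978; arXiv:1211.2778 (LNSS);
LSSY2005 Thm 2.2 (proved in tree: `LSSY2005_upperBound_periodic_holds`) and §1.2 (1.17)–(1.19).
-/

noncomputable section

open MeasureTheory Filter
open scoped ENNReal NNReal ComplexConjugate

namespace Summit.AtomisticToContinuum.BoseEinsteinCondensation.Cruxes.GDTransfer.DysonDressedWitness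

open Literature.MathematicalPhysics.QuantumManyBody.BoseGas
open Summit.AtomisticToContinuum.BoseEinsteinCondensation.Theses.BECThomsonPrinciple
open Summit.AtomisticToContinuum.BoseEinsteinCondensation.Theorems.GaussianDominationCan.Negative
  (cellAvg modeProj theta phase sourceIntegral InWindow)

variable {m : ℕ}

/-! ## §0 Vocabulary (over the landed `Negative.*` objects) -/

/-- The SOURCE PAIRING `σ_n(g, h) = ∫_{cell^N} conj(g) e^{ik·x₀} Θ_h` (conjugate-linear in `g`, linear in
`h`; `k = 2πn/L`).  For Bose-symmetric `g, h`: `N·σ_n(g, h) = ⟨g, Λ_n† h⟩` with the LNSS excitation creator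
`Λ_n† = a_n† a_0 n̂₀^{-1/2}` (`LNSSAlgebra`); the crux's source is `2N|σ_n(Φ, Φ)|` (`srcPair_self`,
`Negative.gaussianDominationCan_iff`). -/
def srcPair (m : ℕ) (L : ℝ) (n : Fin 3 → ℤ) (g h : Config (m + 1) → ℂ) : ℂ :=
  ∫ X in cellN (m + 1) L, conj (g X) * phase m L n X * theta m L h X

/-- The diagonal of the pairing is the crux's source integral (definitionally). -/
theorem srcPair_self (L : ℝ) (n : Fin 3 → ℤ) (ψ : Config (m + 1) → ℂ) :
    srcPair m L n ψ ψ = sourceIntegral m L n ψ := rfl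

/-- The FLAT FOURIER COEFFICIENT in slot `i`: `P_i^{(n)} g (X) = L⁻³ ∫_cell conj(e_n(y)) g(X; x_i ↦ y) dy`
(`e_n = cellWave L n`), i.e. the one-body operator `|φ₀⟩⟨φ_n|` on particle `i` (`a_0† a_n = Σ_i P_i^{(n)}`);
`P_i^{(0)} = P_i = cellAvg`. -/
def fourierAvg (m : ℕ) (L : ℝ) (n : Fin 3 → ℤ) (i : Fin (m + 1)) (g : Config (m + 1) → ℂ) :
    Config (m + 1) → ℂ :=
  fun X => ((L ^ 3)⁻¹ : ℝ) • ∫ y in cell L, conj (cellWave L n y) * g (Function.update X i y)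

/-- The inverse root of the condensate number, `n̂₀^{-1/2} g := Σ_{S ≠ ∅} |S|^{-1/2} Q_S g` (zero on
`ker n̂₀ = ran Q_∅`); `Θ = P₀ ∘ rootInv` on continuous functions. -/
def rootInv (m : ℕ) (L : ℝ) (g : Config (m + 1) → ℂ) : Config (m + 1) → ℂ :=
  fun X => ∑ S ∈ (Finset.univ : Finset (Finset (Fin (m + 1)))).filter (fun S => S.Nonempty),
    ((Real.sqrt (S.card : ℝ))⁻¹ : ℂ) * modeProj (m + 1) L S g X

/-- The LNSS excitation ANNIHILATOR `Λ_n g := n̂₀^{-1/2} a_0† a_n g = rootInv (Σ_i P_i^{(n)} g)`. -/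
def lnssLower (m : ℕ) (L : ℝ) (n : Fin 3 → ℤ) (g : Config (m + 1) → ℂ) : Config (m + 1) → ℂ :=
  rootInv m L (fun X => ∑ i : Fin (m + 1), fourierAvg m L n i g X)

/-- The LNSS excitation CREATOR `Λ_n† g := a_n† a_0 n̂₀^{-1/2} g = Σ_i e_n(x_i) · P_i (rootInv g)`. -/
def lnssUpper (m : ℕ) (L : ℝ) (n : Fin 3 → ℤ) (g : Config (m + 1) → ℂ) : Config (m + 1) → ℂ :=
  fun X => ∑ i : Fin (m + 1), cellWave L n (X i) * cellAvg (m + 1) L i (rootInv m L g) X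

/-- Admissible VARIATION DIRECTIONS at `(N, L) = (m+1, L)`: `C¹`, `Lℤ³`-periodic in every particle,
Bose-symmetric (a `PeriodicTrialState` without the normalisation). -/
structure IsDirection (m : ℕ) (L : ℝ) (ζ : Config (m + 1) → ℂ) : Prop where
  /-- `ζ` is `C¹`. -/
  contDiff : ContDiff ℝ 1 ζ
  /-- `ζ` is `Lℤ³`-periodic in every particle. -/
  periodic : ∀ (X : Config (m + 1)) (i : Fin (m + 1)) (k : Fin 3),
    ζ (X + Pi.single i (EuclideanSpace.single k L)) = ζ X
  /-- `ζ` is Bose-symmetric. -/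
  symm : ∀ (σ : Equiv.Perm (Fin (m + 1))) (X : Config (m + 1)), ζ (X ∘ σ) = ζ X

/-- `‖ζ‖² = ∫_{cell^N} |ζ|²` (the mass of a direction). -/
def mass (L : ℝ) (ζ : Config (m + 1) → ℂ) : ℝ≥0∞ :=
  ∫⁻ X in cellN (m + 1) L, (‖ζ X‖₊ : ℝ≥0∞) ^ 2

/-- `𝓔(ζ) = ∫_{cell^N} (|∇ζ|² + Σ_{i<j} v^per(xᵢ−xⱼ)|ζ|²)` — the periodic energy FORM of an unnormalised
function (`= periodicEnergy` on trial states).  The excess form is `q̃(ζ) = 𝓔(ζ) − E₀‖ζ‖²`. -/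
def eform (v : ℝ → ℝ≥0∞) (L : ℝ) (ζ : Config (m + 1) → ℂ) : ℝ≥0∞ :=
  ∫⁻ X in cellN (m + 1) L, kineticDensity ζ X + periodicInteraction v L X * (‖ζ X‖₊ : ℝ≥0∞) ^ 2

/-- A periodic trial state is a direction. -/
theorem isDirection_trialState {L : ℝ} (Ψ : PeriodicTrialState (m + 1) L) : IsDirection m L Ψ.ψ :=
  ⟨Ψ.contDiff, Ψ.periodic, Ψ.symm⟩

/-- Its mass is `1`. -/
theorem mass_trialState {L : ℝ} (Ψ : PeriodicTrialState (m + 1) L) : mass L Ψ.ψ = 1 := Ψ.norm_eq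

/-- Its energy form is its periodic energy (by `rfl`). -/
theorem eform_trialState {L : ℝ} (v : ℝ → ℝ≥0∞) (Ψ : PeriodicTrialState (m + 1) L) :
    eform v L Ψ.ψ = periodicEnergy v Ψ := rfl

/-- `Σ_{p ∈ window(M)} f p` — sum over the crux's window modes `p ≠ 0`, `2π‖p‖_∞/L ≤ M√(N/L³)`
(a `tsum` of an indicator; the window is finite, `#window ≤ (2J+1)³`, `J = M√ρ L/2π`). -/
def windowSum (M : ℝ) (m : ℕ) (L : ℝ) (f : (Fin 3 → ℤ) → ℝ≥0∞) : ℝ≥0∞ :=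
  ∑' p : Fin 3 → ℤ, {p | p ≠ 0 ∧ InWindow M m L p}.indicator f p

/-! ## §1 The intermediate statements of the line -/

/-- TWO-SIDED DUAL-NORM BOUND AT NEAR-MINIMISERS (output of `stub_chordVariation`; the ONLY place GD is
consumed): with GD's `ρ₀, C, N₀`, for `N = m+1 ≥ N₀`, `N ≤ ρ₀L³`, `E₀ < ∞`, every `η > 0` and radius `R`, ONE
slack `δ > 0` such that for every `δ`-near-minimiser `Ψ`, window mode `n` and directions `ζ±` of mass and form
`≤ R`: `(N|σ(ζ₊,Ψ) + σ(Ψ,ζ₋)|)² + 2C_kE₀(‖ζ₊‖² + ‖ζ₋‖²) ≤ 2C_k(𝓔(ζ₊) + 𝓔(ζ₋)) + η`, `C_k = CL²/‖n‖²`. -/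
def TwoSidedDualNorm : Prop :=
  ∀ v : ℝ → ℝ≥0∞, IsRepulsiveFiniteRange v → ∀ M : ℝ, 0 < M →
    ∃ ρ₀ C : ℝ, 0 < ρ₀ ∧ 0 < C ∧ ∃ N₀ : ℕ, ∀ m : ℕ, N₀ ≤ m + 1 →
      ∀ L : ℝ, 0 < L → ((m + 1 : ℕ) : ℝ) ≤ ρ₀ * L ^ 3 →
        periodicGroundStateEnergy v (m + 1) L ≠ ⊤ →
        ∀ η R : ℝ, 0 < η → 0 < R →
          ∃ δ : ℝ≥0∞, 0 < δ ∧ ∀ Ψ : PeriodicTrialState (m + 1) L,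
            periodicEnergy v Ψ ≤ periodicGroundStateEnergy v (m + 1) L + δ →
            ∀ n : Fin 3 → ℤ, n ≠ 0 → InWindow M m L n →
            ∀ ζp ζm : Config (m + 1) → ℂ, IsDirection m L ζp → IsDirection m L ζm →
              mass L ζp ≤ ENNReal.ofReal R → mass L ζm ≤ ENNReal.ofReal R →
              eform v L ζp ≤ ENNReal.ofReal R → eform v L ζm ≤ ENNReal.ofReal R →
                ENNReal.ofReal ((((m + 1 : ℕ) : ℝ) * ‖srcPair m L n ζp Ψ.ψ + srcPair m L n Ψ.ψ ζm‖) ^ 2) +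
                    ENNReal.ofReal (2 * C * L ^ 2 / ‖(fun j => (n j : ℝ))‖ ^ 2) *
                      periodicGroundStateEnergy v (m + 1) L * (mass L ζp + mass L ζm) ≤
                  ENNReal.ofReal (2 * C * L ^ 2 / ‖(fun j => (n j : ℝ))‖ ^ 2) *
                      (eform v L ζp + eform v L ζm) +
                    ENNReal.ofReal η

/-- THE LNSS CONFIGURATION-SPACE ALGEBRA (output of `stub_lnssAlgebra`): for every periodic trial state `Ψ`
and `n ∈ ℤ³`: (L1) `Λ_nΨ`, `Λ_n†Ψ` are directions; (L2) `N·σ_n(g, Ψ) = ⟨g, Λ_n†Ψ⟩` and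
`N·σ_n(Ψ, g) = ⟨Λ_nΨ, g⟩` for every direction `g`; (L3) `‖Λ_nΨ‖² = n_n(Ψ)` (`Λ†Λ = n̂_n`). -/
def LNSSAlgebra : Prop :=
  ∀ (m : ℕ) (L : ℝ), 0 < L → ∀ (n : Fin 3 → ℤ) (Ψ : PeriodicTrialState (m + 1) L),
    IsDirection m L (lnssLower m L n Ψ.ψ) ∧ IsDirection m L (lnssUpper m L n Ψ.ψ) ∧
    (∀ g : Config (m + 1) → ℂ, IsDirection m L g →
      ((m + 1 : ℕ) : ℂ) * srcPair m L n g Ψ.ψ =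
          ∫ X in cellN (m + 1) L, conj (g X) * lnssUpper m L n Ψ.ψ X ∧
      ((m + 1 : ℕ) : ℂ) * srcPair m L n Ψ.ψ g =
          ∫ X in cellN (m + 1) L, conj (lnssLower m L n Ψ.ψ X) * g X) ∧
    mass L (lnssLower m L n Ψ.ψ) = cellOccupation (m + 1) L (planeWaveMode L n) Ψ.ψ

/-- A-PRIORI BOUNDS AND ZERO-DEFECT RESPONSE OF THE BARE PAIR (output of `stub_bareAdmissible`): for integrable
`v`, at every `(N, L)` some `R₀` bounds the masses of `Λ_n†Ψ`, `Λ_nΨ` and, with the factor `(1 + ‖n‖²)(E(Ψ) + 1)`,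
their energy forms; (W3) with zero defect `‖Λ†Ψ‖² + ‖ΛΨ‖² ≤ 2N|σ(Λ†Ψ, Ψ) + σ(Ψ, ΛΨ)|` and (W4)
`n_n(Ψ) ≤ 2‖Λ_nΨ‖²` (by (L2), (L3)). -/
def BareAdmissibility : Prop :=
  ∀ v : ℝ → ℝ≥0∞, IsRepulsiveFiniteRange v → (∫⁻ x : Space, v ‖x‖) ≠ ⊤ →
    ∀ (m : ℕ) (L : ℝ), 0 < L → ∃ R₀ : ℝ, 0 < R₀ ∧
      ∀ (n : Fin 3 → ℤ) (Ψ : PeriodicTrialState (m + 1) L),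
        mass L (lnssUpper m L n Ψ.ψ) ≤ ENNReal.ofReal R₀ ∧
        mass L (lnssLower m L n Ψ.ψ) ≤ ENNReal.ofReal R₀ ∧
        eform v L (lnssUpper m L n Ψ.ψ) ≤
          ENNReal.ofReal (R₀ * (1 + ‖(fun j => (n j : ℝ))‖ ^ 2)) * (periodicEnergy v Ψ + 1) ∧
        eform v L (lnssLower m L n Ψ.ψ) ≤
          ENNReal.ofReal (R₀ * (1 + ‖(fun j => (n j : ℝ))‖ ^ 2)) * (periodicEnergy v Ψ + 1) ∧
        mass L (lnssUpper m L n Ψ.ψ) + mass L (lnssLower m L n Ψ.ψ) ≤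
          2 * ENNReal.ofReal (((m + 1 : ℕ) : ℝ) *
            ‖srcPair m L n (lnssUpper m L n Ψ.ψ) Ψ.ψ + srcPair m L n Ψ.ψ (lnssLower m L n Ψ.ψ)‖) ∧
        cellOccupation (m + 1) L (planeWaveMode L n) Ψ.ψ ≤ 2 * mass L (lnssLower m L n Ψ.ψ)

/-- THE BARE SECOND VARIATION (output of `stub_bareSecondVariation`; the KLS double commutator for
integrable `v`): constants `c₁, c₂` (after `v`; `c₂ ≍ ‖v‖₁`) such that at every `(N, L)` with `E₀ < ∞` there is
a slack `δ > 0` with, for every `δ`-near-minimiser `Ψ` and every `n`,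
`𝓔(Λ†Ψ) + 𝓔(ΛΨ) ≤ E₀(‖Λ†Ψ‖² + ‖ΛΨ‖²) + (c₁k_∞² + c₂ρ)(1 + ‖Λ†Ψ‖² + ‖ΛΨ‖²)`, `ρ = N/L³`, `k_∞ = 2π‖n‖_∞/L`.
Mechanism: parallelogram to `A± = Λ+Λ†, i(Λ†−Λ)`; for hermitian `A`, `q̃(AΨ) = D_A(Ψ) + Re q̃(A²Ψ, Ψ)`,
`|q̃(A²Ψ,Ψ)| ≤ √(q̃(A²Ψ)·δ)`; kinetic part of `D_A` exactly `|k|²(‖Λ†Ψ‖² − ‖ΛΨ‖²)` from the form identity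
`t(f, Λ†g) − t(Λf, g) = |k|²⟨f, Λ†g⟩`; interaction part `≤ cρ‖v‖₁(1 + ‖Λ†Ψ‖² + ‖ΛΨ‖²)` (two-body locality). -/
def BareSecondVariation : Prop :=
  ∀ v : ℝ → ℝ≥0∞, IsRepulsiveFiniteRange v → (∫⁻ x : Space, v ‖x‖) ≠ ⊤ →
    ∃ c₁ c₂ : ℝ, 0 < c₁ ∧ 0 < c₂ ∧ ∀ (m : ℕ) (L : ℝ), 0 < L →
      periodicGroundStateEnergy v (m + 1) L ≠ ⊤ →
      ∃ δ : ℝ≥0∞, 0 < δ ∧ ∀ Ψ : PeriodicTrialState (m + 1) L,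
        periodicEnergy v Ψ ≤ periodicGroundStateEnergy v (m + 1) L + δ →
        ∀ n : Fin 3 → ℤ,
          eform v L (lnssUpper m L n Ψ.ψ) + eform v L (lnssLower m L n Ψ.ψ) ≤
            periodicGroundStateEnergy v (m + 1) L *
                (mass L (lnssUpper m L n Ψ.ψ) + mass L (lnssLower m L n Ψ.ψ)) +
              ENNReal.ofReal
                ((c₁ * (2 * Real.pi * ‖(fun j => (n j : ℝ))‖ / L) ^ 2 + c₂ * (((m + 1 : ℕ) : ℝ) / L ^ 3)) *
                  (1 + (mass L (lnssUpper m L n Ψ.ψ) + mass L (lnssLower m L n Ψ.ψ)).toReal))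

/-- WITNESS FAMILY FOR ONE POTENTIAL (the interface fed to `stub_windowLaw`; the bare pair for integrable `v`,
`dwf_of_bare`; the dressed pair otherwise, `stub_dressedWitness`): for every `M`, constants `ρ₁, c₁, c₂, γ, N₁`;
for `N ≥ N₁`, `N ≤ ρ₁L³`, `E₀ < ∞` a radius `R` and a slack `δ`; for every `δ`-near-minimiser a defect budget
`d` with window sum `≤ γ√ρN`; per window mode directions `ζ±` of mass/form `≤ R` with
(W2) `𝓔(ζ₊) + 𝓔(ζ₋) ≤ E₀(‖ζ₊‖² + ‖ζ₋‖²) + (c₁k_∞² + c₂ρ)(1 + ‖ζ₊‖² + ‖ζ₋‖²)`,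
(W3) `‖ζ₊‖² + ‖ζ₋‖² ≤ 2N|σ(ζ₊,Ψ) + σ(Ψ,ζ₋)| + d(n)`, (W4) `n_n(Ψ) ≤ 2‖ζ₋‖² + d(n)`. -/
def DressedWitnessFamilyFor (v : ℝ → ℝ≥0∞) : Prop :=
  ∀ M : ℝ, 0 < M →
    ∃ ρ₁ c₁ c₂ γ : ℝ, 0 < ρ₁ ∧ 0 < c₁ ∧ 0 < c₂ ∧ 0 < γ ∧ ∃ N₁ : ℕ, ∀ m : ℕ, N₁ ≤ m + 1 →
      ∀ L : ℝ, 0 < L → ((m + 1 : ℕ) : ℝ) ≤ ρ₁ * L ^ 3 →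
        periodicGroundStateEnergy v (m + 1) L ≠ ⊤ →
        ∃ R : ℝ, 0 < R ∧ ∃ δ : ℝ≥0∞, 0 < δ ∧ ∀ Ψ : PeriodicTrialState (m + 1) L,
          periodicEnergy v Ψ ≤ periodicGroundStateEnergy v (m + 1) L + δ →
          ∃ d : (Fin 3 → ℤ) → ℝ≥0∞,
            windowSum M m L d ≤
                ENNReal.ofReal (γ * Real.sqrt (((m + 1 : ℕ) : ℝ) / L ^ 3) * (m + 1)) ∧
            ∀ n : Fin 3 → ℤ, n ≠ 0 → InWindow M m L n →
              ∃ ζp ζm : Config (m + 1) → ℂ, IsDirection m L ζp ∧ IsDirection m L ζm ∧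
                mass L ζp ≤ ENNReal.ofReal R ∧ mass L ζm ≤ ENNReal.ofReal R ∧
                eform v L ζp ≤ ENNReal.ofReal R ∧ eform v L ζm ≤ ENNReal.ofReal R ∧
                eform v L ζp + eform v L ζm ≤
                    periodicGroundStateEnergy v (m + 1) L * (mass L ζp + mass L ζm) +
                      ENNReal.ofReal
                        ((c₁ * (2 * Real.pi * ‖(fun j => (n j : ℝ))‖ / L) ^ 2 +
                            c₂ * (((m + 1 : ℕ) : ℝ) / L ^ 3)) *
                          (1 + (mass L ζp + mass L ζm).toReal)) ∧
                mass L ζp + mass L ζm ≤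
                    2 * ENNReal.ofReal (((m + 1 : ℕ) : ℝ) *
                      ‖srcPair m L n ζp Ψ.ψ + srcPair m L n Ψ.ψ ζm‖) + d n ∧
                cellOccupation (m + 1) L (planeWaveMode L n) Ψ.ψ ≤ 2 * mass L ζm + d n

/-- WINDOW BOUND FOR ONE POTENTIAL (output of `stub_windowLaw`): for every `M` there are `ρ₁, K, N₁` such
that for `N = m+1 ≥ N₁`, `L > 0`, `N ≤ ρ₁L³`, `E₀ < ∞`, some slack `δ > 0` makes every `δ`-near-minimiser
satisfy `Σ_{0 < 2π‖p‖_∞/L ≤ M√ρ} n_p(Ψ) ≤ K √ρ N` (`ρ = N/L³`). -/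
def WindowBoundFor (v : ℝ → ℝ≥0∞) : Prop :=
  ∀ M : ℝ, 0 < M →
    ∃ ρ₁ K : ℝ, 0 < ρ₁ ∧ 0 < K ∧ ∃ N₁ : ℕ, ∀ m : ℕ, N₁ ≤ m + 1 →
      ∀ L : ℝ, 0 < L → ((m + 1 : ℕ) : ℝ) ≤ ρ₁ * L ^ 3 →
        periodicGroundStateEnergy v (m + 1) L ≠ ⊤ →
        ∃ δ : ℝ≥0∞, 0 < δ ∧ ∀ Ψ : PeriodicTrialState (m + 1) L,
          periodicEnergy v Ψ ≤ periodicGroundStateEnergy v (m + 1) L + δ →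
            windowSum M m L (fun p => cellOccupation (m + 1) L (planeWaveMode L p) Ψ.ψ) ≤
              ENNReal.ofReal (K * Real.sqrt (((m + 1 : ℕ) : ℝ) / L ^ 3) * (m + 1))

/-- The consequent of the crux for ONE potential — verbatim the `PeriodicBEC` body of `GDTransfer`
(`gdTransfer_iff`). -/
def PeriodicBECFor (v : ℝ → ℝ≥0∞) : Prop :=
  ∃ ρ₀ : ℝ, 0 < ρ₀ ∧ ∀ ρ : ℝ, 0 < ρ → ρ < ρ₀ → ∃ c : ℝ, 0 < c ∧ ∀ᶠ N : ℕ in Filter.atTop,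
    ∃ δ : ENNReal, 0 < δ ∧ ∀ Ψ : PeriodicTrialState N (sideLength ρ N),
      periodicEnergy v Ψ ≤ periodicGroundStateEnergy v N (sideLength ρ N) + δ →
        ENNReal.ofReal (c * N) ≤ condensateOccupation N (sideLength ρ N) Ψ.ψ

/-- The crux, literally, is `GDCan → ∀ v admissible, PeriodicBECFor v` (definitional). -/
theorem gdTransfer_iff :
    GDTransfer ↔
      (GaussianDominationCan → ∀ v : ℝ → ℝ≥0∞, IsRepulsiveFiniteRange v → PeriodicBECFor v) :=
  Iff.rfl

/-! ## §2 Stub signatures (`Sig.stub_<name>` = the registered signature) -/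

/-- Registered signature of `stub_modeCounting` [size M, provable now]: Parseval on the cell + kinetic
Chebyshev above the window + Dyson's upper bound (template `Theorems.ModeCounting.condensate_ge_half`). -/
def Sig.stub_modeCounting : Prop :=
  ∀ v : ℝ → ℝ≥0∞, IsRepulsiveFiniteRange v → WindowBoundFor v → PeriodicBECFor v

/-- Registered signature of `stub_windowLaw` [size M, elementary]: per-mode solve of the quadratic inequality
(dual norm + (W2)–(W4)) and the `ℤ³` window counts `#{0<‖n‖_∞≤J} ≤ (2J+1)³`, `Σ ‖n‖_∞⁻² ≤ 26J`. -/
def Sig.stub_windowLaw : Prop :=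
  TwoSidedDualNorm → ∀ v : ℝ → ℝ≥0∞, IsRepulsiveFiniteRange v →
    DressedWitnessFamilyFor v → WindowBoundFor v

/-- Registered signature of `stub_chordVariation` [size L]: GD in square form (`Negative.forall_gdIneq_iff`)
along `(Ψ + tζ_θ)/‖·‖` (`PeriodicTrialState.ofFun`), `t = δ^{1/4}`, phase choice, parallelogram law. -/
def Sig.stub_chordVariation : Prop :=
  GaussianDominationCan → TwoSidedDualNorm

/-- Registered signature of `stub_lnssAlgebra` [size M/L]: regularity of cell averages, the swap `0 ↔ i`,
self-adjointness of `P_i`, and `‖Λ_nΨ‖² = n_n` by the one-variable cell Parseval. -/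
def Sig.stub_lnssAlgebra : Prop :=
  LNSSAlgebra

/-- Registered signature of `stub_bareAdmissible` [size M/L]: `‖P_i h‖ ≤ ‖h‖`, `[∇_j, P_i] = 0` on periodic
functions, Jensen for the interaction of cell-averaged functions (`∫_cell v^per = ‖v‖₁`), and (L2)/(L3). -/
def Sig.stub_bareAdmissible : Prop :=
  LNSSAlgebra → BareAdmissibility

/-- Registered signature of `stub_bareSecondVariation` [size L/XL; the soft-potential content]: the KLS double
commutator at near-minimisers (mechanism in the docstring of `BareSecondVariation`). -/
def Sig.stub_bareSecondVariation : Prop :=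
  LNSSAlgebra → BareAdmissibility → BareSecondVariation

/-- Registered signature of `stub_dressedWitness` [size XL; HARDEST; held by the lead]: the Dyson-dressed
core-safe pair `Λ̃_k†Ψ`, `Λ̃_kΨ` (`Λ̃_k = G(ñ₀)(Σᵢ FᵢPᵢe^{-ik·xᵢ}Fᵢ)G(ñ₀)`, `Fᵢ = Π_{j≠i} f(xᵢ−xⱼ)`) for
non-integrable `v`; (W2) by local commutators, (W3)/(W4) with a window-summed dressing defect. -/
def Sig.stub_dressedWitness : Prop :=
  LNSSAlgebra → ∀ v : ℝ → ℝ≥0∞, IsRepulsiveFiniteRange v → (∫⁻ x : Space, v ‖x‖) = ⊤ →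
    DressedWitnessFamilyFor v

/-! ## §3 Composition (sorry-free): the seven stub statements give the crux BY NAME -/

/-- A window sum of the zero budget vanishes. -/
theorem windowSum_zero (M : ℝ) (m : ℕ) (L : ℝ) : windowSum M m L (fun _ => 0) = 0 := by
  unfold windowSum
  simp

/-- **The bare pair is a witness family for integrable `v`** (glue: constants `ρ₁ = γ = 1`, `N₁ = 0`,
`R = R₀(1 + J²)(E₀ + 2)` with `J = M√ρ L/2π` the window radius, `δ = min δ_SV 1`, zero defect). -/
theorem dwf_of_bare (hLA : LNSSAlgebra) (hA : BareAdmissibility) (hS : BareSecondVariation) :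
    ∀ v : ℝ → ℝ≥0∞, IsRepulsiveFiniteRange v → (∫⁻ x : Space, v ‖x‖) ≠ ⊤ →
      DressedWitnessFamilyFor v := by
  intro v hv hint M hM
  obtain ⟨c₁, c₂, hc₁, hc₂, hSV⟩ := hS v hv hint
  refine ⟨1, c₁, c₂, 1, one_pos, hc₁, hc₂, one_pos, 0, ?_⟩
  intro m _ L hL _ hE0
  obtain ⟨R₀, hR₀, hAd⟩ := hA v hv hint m L hL
  obtain ⟨δ, hδ, hSVΨ⟩ := hSV m L hL hE0
  set Jr : ℝ := M * Real.sqrt (((m + 1 : ℕ) : ℝ) / L ^ 3) * L / (2 * Real.pi) with hJr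
  set E0r : ℝ := (periodicGroundStateEnergy v (m + 1) L).toReal with hE0r
  have hE0r0 : 0 ≤ E0r := ENNReal.toReal_nonneg
  have hE0eq : periodicGroundStateEnergy v (m + 1) L = ENNReal.ofReal E0r :=
    (ENNReal.ofReal_toReal hE0).symm
  set R : ℝ := R₀ * (1 + Jr ^ 2) * (E0r + 2) with hR
  have hRpos : 0 < R := by positivity
  have hR₀R : R₀ ≤ R := by
    have h1 : (1 : ℝ) ≤ (1 + Jr ^ 2) * (E0r + 2) := by nlinarith [sq_nonneg Jr, hE0r0]
    calc R₀ = R₀ * 1 := (mul_one _).symm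
      _ ≤ R₀ * ((1 + Jr ^ 2) * (E0r + 2)) := by gcongr
      _ = R := by rw [hR]; ring
  refine ⟨R, hRpos, min δ 1, lt_min hδ one_pos, ?_⟩
  intro Ψ hΨ
  have hΨδ : periodicEnergy v Ψ ≤ periodicGroundStateEnergy v (m + 1) L + δ :=
    hΨ.trans (add_le_add le_rfl (min_le_left _ _))
  have hΨ1 : periodicEnergy v Ψ + 1 ≤ ENNReal.ofReal (E0r + 2) := by
    calc periodicEnergy v Ψ + 1 ≤ periodicGroundStateEnergy v (m + 1) L + min δ 1 + 1 := by gcongr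
      _ ≤ ENNReal.ofReal E0r + 1 + 1 := by rw [hE0eq]; gcongr; exact min_le_right _ _
      _ = ENNReal.ofReal (E0r + 2) := by
          rw [add_assoc, ← one_add_one_eq_two, ENNReal.ofReal_add hE0r0 (by norm_num)]
          norm_num
  refine ⟨fun _ => 0, ?_, ?_⟩
  · rw [windowSum_zero]; exact bot_le
  · intro n hn hwin
    obtain ⟨h1, h2, h3, h4, h5, h6⟩ := hAd n Ψ
    obtain ⟨hdirm, hdirp, -, -⟩ := hLA m L hL n Ψ
    -- the window radius bounds `‖n‖`
    have hnJ : ‖(fun j => (n j : ℝ))‖ ≤ Jr := by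
      have hw : 2 * Real.pi * ‖(fun j => (n j : ℝ))‖ / L ≤
          M * Real.sqrt (((m + 1 : ℕ) : ℝ) / L ^ 3) := hwin
      rw [div_le_iff₀ hL] at hw
      rw [hJr, le_div_iff₀ (by positivity)]
      linarith
    have hfac : R₀ * (1 + ‖(fun j => (n j : ℝ))‖ ^ 2) ≤ R₀ * (1 + Jr ^ 2) := by
      have h0 : 0 ≤ ‖(fun j => (n j : ℝ))‖ := norm_nonneg _
      gcongr
    have heform : ∀ {e : ℝ≥0∞},
        e ≤ ENNReal.ofReal (R₀ * (1 + ‖(fun j => (n j : ℝ))‖ ^ 2)) * (periodicEnergy v Ψ + 1) →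
          e ≤ ENNReal.ofReal R := by
      intro e he
      calc e ≤ ENNReal.ofReal (R₀ * (1 + ‖(fun j => (n j : ℝ))‖ ^ 2)) * (periodicEnergy v Ψ + 1) := he
        _ ≤ ENNReal.ofReal (R₀ * (1 + Jr ^ 2)) * ENNReal.ofReal (E0r + 2) := by
            gcongr
        _ = ENNReal.ofReal R := by
            rw [← ENNReal.ofReal_mul (by positivity), hR]
    refine ⟨lnssUpper m L n Ψ.ψ, lnssLower m L n Ψ.ψ, hdirp, hdirm,
      h1.trans (ENNReal.ofReal_le_ofReal hR₀R), h2.trans (ENNReal.ofReal_le_ofReal hR₀R),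
      heform h3, heform h4, hSVΨ Ψ hΨδ n, ?_, ?_⟩
    · simpa only [add_zero] using h5
    · simpa only [add_zero] using h6

/-- **The line concludes the crux BY NAME**: GD ⟶ (stub 3) two-sided dual-norm bound ⟶ (stub 2, fed with
the witness family of stubs 4–6 for integrable `v` and of stub 7 otherwise) window bound ⟶ (stub 1)
condensation of the near-minimisers. -/
theorem GDTransfer_of :
    Sig.stub_modeCounting → Sig.stub_windowLaw → Sig.stub_chordVariation → Sig.stub_lnssAlgebra →
      Sig.stub_bareAdmissible → Sig.stub_bareSecondVariation → Sig.stub_dressedWitness →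
        GDTransfer := by
  intro hMC hWL hCV hLA hBA hBS hDW
  refine gdTransfer_iff.mpr fun hGD v hv => ?_
  have hT : TwoSidedDualNorm := hCV hGD
  by_cases hint : (∫⁻ x : Space, v ‖x‖) = ⊤
  · exact hMC v hv (hWL hT v hv (hDW hLA v hv hint))
  · exact hMC v hv (hWL hT v hv (dwf_of_bare hLA (hBA hLA) (hBS hLA (hBA hLA)) v hv hint))

end Summit.AtomisticToContinuum.BoseEinsteinCondensation.Cruxes.GDTransfer.DysonDressedWitness

end
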